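/-
Copyright (c) 2026. All rights reserved.
Released under Apache 2.0 license as described in the file LICENSE.
Authors: HodgeCM publication cell (pub-hodgecm), GR lane, seat own-crow (`pub-hodgecm-own-crow`).
-/
import Literature.NumberTheory.GelbartRogawski1991.UnitaryDualPairSplittingDatumCongruence
import HarnessLib

/-!
# [GelbartRogawski1991, Prop. 3.1.1] as a record is invariant under `F`-rational congruence of the hermitian
# Gram data — the transport theorem

Topic `NumberTheory/GelbartRogawski1991`; namespace `Literature.NumberTheory.GelbartRogawski1991.UnitaryDualPair`
(sequel of `UnitaryDualPairSplittingDatumCongruence`, which built the transport data `eG = congrPair`, `eSp = congrSp`,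
`φ = congrMp`, `e₀ = congrSpRat` and the clauses `hproj`, `hrat`, `he₀`, `huniq`).  KERNEL only; no `def … : Prop`, no named
fact, no proof hole.

THIS FILE supplies the last clause and the conclusion:

* `toSp_congr` / `congrDatum_toSp` — **`ι′ = eSp ∘ ι ∘ eG`**: the restriction of scalars `R` (`resAut`, a homomorphism on all of
  `GL_{NM}(𝔸_E)`) of `P g P⁻¹` is `R(P) R(g) R(P)⁻¹`, and through the reindexing `ρ = reindexW e` one has
  `Λ_C ∘ π(q) ∘ ρ R(P) ρ⁻¹ = 1` (`congrRelabelLin_congrLeviLin_congrResLin`: `𝕡̂⁻¹ 𝕡̂ = 1` on the `X`-half,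
  `C 𝕋⁻¹ 𝕡̂ᵀ 𝕋 𝕡̂ = 𝕋′⁻¹ 𝕋′ = 1` on the `Y`-half, `resAut_map` for the `F`-rational `P = (P_V ⊗ₖ P_W) ⊗ 1`);
* **`compatibleSplitting_congr`**: `CompatibleSplitting` for the dual pair of `(T_V, T_W)` ⇒ `CompatibleSplitting` for
  `(P_Vᵀ T_V P_V, P_Wᵀ T_W P_W)`, every `P_V ∈ GL_N(F)`, `P_W ∈ GL_M(F)` (`SplittingDatum.CompatibleSplitting.transport_of_unique`).

Consumer: `Prop311AsPrintedSymmetricOfDiagonal` (`Prop311.SymmetricCompatibleSplitting ⇐ Prop311.DiagonalCompatibleSplitting`).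

## References
* [GelbartRogawski1991] S. Gelbart, J. Rogawski, Invent. Math. 105 (1991) 445–472, §3.1 p. 454 L17–42, Prop. 3.1.1 p. 455 L1–3.
* [MoeglinVignerasWaldspurger1987] C. Mœglin, M.-F. Vignéras, J.-L. Waldspurger, LNM 1291 (1987), Chap. 2 II.1 (A)–(B).
* [Weil1964] A. Weil, Acta Math. 111 (1964), Chap. I n° 13 p. 160 (`d₀(α)`), Chap. III n° 40–41 pp. 190–193 (`r_k`).
-/

set_option autoImplicit false

noncomputable section

open scoped Matrix Kronecker
open NumberField
open Literature.RepresentationTheory.HeisenbergGroup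
open Literature.RepresentationTheory.HeisenbergGroup.SymplecticMatrix (transportSp mapHom levi glEquiv leviDual
  leviDual_compat glEquiv_apply leviDual_apply coe_transportSp_apply darboux darboux_apply darboux_symm_apply transportSp_levi
  mapHom_levi coe_levi coe_mapHom)
open Literature.NumberTheory.Automorphic
open Literature.NumberTheory.Automorphic.UnitaryGroup (symplecticGroupCongr coe_symplecticGroupCongr_apply)
open Literature.NumberTheory.Weil1964

namespace Literature.NumberTheory.GelbartRogawski1991

namespace UnitaryDualPair

/-! ## §5 `ι′ = eSp ∘ ι ∘ eG` and the transport theorem -/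

section Transport

variable (F E : Type) [Field F] [NumberField F] [Field E] [NumberField E] [Algebra F E]
variable (c : E ≃ₐ[F] E) {N M n : ℕ} (e : Fin N × Fin M ≃ Fin n)
variable [Algebra.IsQuadraticExtension F E] {δ : E} (hcδ : c δ = -δ) (hδ : δ ≠ 0) {d : F}
  (hd : δ * δ = algebraMap F E d)
variable {TV : Matrix (Fin N) (Fin N) F} {TW : Matrix (Fin M) (Fin M) F}
variable (hV : TV.IsSymm) (hW : TW.IsSymm) (hVd : IsUnit TV.det) (hWd : IsUnit TW.det)
variable {PV : Matrix (Fin N) (Fin N) F} {PW : Matrix (Fin M) (Fin M) F} (hPV : IsUnit PV.det) (hPW : IsUnit PW.det)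

/-- `ι` in coordinates: `(toSp g) v = ρ (R(g) (ρ⁻¹ v))`, `ρ = reindexW e`, `R =` restriction of scalars (`resAut`).
[cite: GelbartRogawski1991, §3.1 p. 454 L41–42] -/
theorem coe_toSp_apply {JV : Matrix (Fin N) (Fin N) E} {JW : Matrix (Fin M) (Fin M) E}
    {TV₀ : Matrix (Fin N) (Fin N) F} {TW₀ : Matrix (Fin M) (Fin M) F} (hV₀ : TV₀.IsSymm) (hW₀ : TW₀.IsSymm)
    (hJV : JV = TV₀.map (algebraMap F E)) (hJW : JW = TW₀.map (algebraMap F E))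
    (g : UnitaryGroup.adelicPair F E c N M JV JW) (v : ((Fin n → AdeleRing (𝓞 F) F) × (Fin n → AdeleRing (𝓞 F) F))) :
    ((toSp F E c N M e JV JW hcδ hδ hd hV₀ hW₀ hJV hJW g : symplecticGroup (polar (adelicForm F (Fin n) (adelicGram F e TV₀ TW₀)))) :
        ((Fin n → AdeleRing (𝓞 F) F) × (Fin n → AdeleRing (𝓞 F) F)) ≃ₗ[AdeleRing (𝓞 F) F] ((Fin n → AdeleRing (𝓞 F) F) × (Fin n → AdeleRing (𝓞 F) F))) v =
      UnitaryGroup.reindexW (AdeleRing (𝓞 F) F) e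
        ((UnitaryGroup.isQuadraticCoordinates_adele E c hcδ hδ hd).resAut (Fin N × Fin M)
          (g : GL (Fin N × Fin M) (AdeleRing (𝓞 E) E)) ((UnitaryGroup.reindexW (AdeleRing (𝓞 F) F) e).symm v)) :=
  rfl

/-- the relabelling `Λ_C`, `C = 𝕋′⁻¹ 𝕋`, as a linear automorphism of `𝕎_𝔸` (abbreviation). [cite: MoeglinVignerasWaldspurger1987, Chap. 2 II.1 (B)] -/
abbrev congrRelabelLin : ((Fin n → AdeleRing (𝓞 F) F) × (Fin n → AdeleRing (𝓞 F) F)) ≃ₗ[AdeleRing (𝓞 F) F] ((Fin n → AdeleRing (𝓞 F) F) × (Fin n → AdeleRing (𝓞 F) F)) :=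
  relabelVec F (Fin n) (relabelGL F (Fin n) (isUnit_det_adelicGram_congr F e hVd hWd hPV hPW)
    (isUnit_det_adelicGram F e hVd hWd))

/-- `π(q)`, the Levi element `m_𝕋(𝕡⁻¹)`, as a linear automorphism of `𝕎_𝔸` (abbreviation). [cite: Weil1964, Chap. I n° 13 p. 160] -/
abbrev congrLeviLin : ((Fin n → AdeleRing (𝓞 F) F) × (Fin n → AdeleRing (𝓞 F) F)) ≃ₗ[AdeleRing (𝓞 F) F] ((Fin n → AdeleRing (𝓞 F) F) × (Fin n → AdeleRing (𝓞 F) F)) :=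
  ((adelicMpCont.proj F (Fin n) _ (congrLeviPair F e hVd hWd hPV hPW) :
      symplecticGroup (polar (adelicForm F (Fin n) (adelicGram F e TV TW)))) : ((Fin n → AdeleRing (𝓞 F) F) × (Fin n → AdeleRing (𝓞 F) F)) ≃ₗ[AdeleRing (𝓞 F) F] ((Fin n → AdeleRing (𝓞 F) F) × (Fin n → AdeleRing (𝓞 F) F)))

/-- restriction of scalars of `P = (P_V ⊗ₖ P_W) ⊗ 1` read through the reindexing `e` (abbreviation).
[cite: GelbartRogawski1991, §3.1 p. 454 L41–42] -/
abbrev congrResLin : ((Fin n → AdeleRing (𝓞 F) F) × (Fin n → AdeleRing (𝓞 F) F)) ≃ₗ[AdeleRing (𝓞 F) F] ((Fin n → AdeleRing (𝓞 F) F) × (Fin n → AdeleRing (𝓞 F) F)) :=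
  ((UnitaryGroup.reindexW (AdeleRing (𝓞 F) F) e).symm.trans
    ((UnitaryGroup.isQuadraticCoordinates_adele E c hcδ hδ hd).resAut (Fin N × Fin M) (kronGLAdele F E N M hPV hPW))).trans
    (UnitaryGroup.reindexW (AdeleRing (𝓞 F) F) e)

/-- `eSp` in coordinates: `(eSp x) v = Λ_C (π(q) (x (π(q)⁻¹ (Λ_C⁻¹ v))))`. [cite: GelbartRogawski1991, §3.1 p. 454 L41–42] -/
theorem coe_congrSp_apply (x : symplecticGroup (polar (adelicForm F (Fin n) (adelicGram F e TV TW)))) (v : ((Fin n → AdeleRing (𝓞 F) F) × (Fin n → AdeleRing (𝓞 F) F))) :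
    ((congrSp F e hVd hWd hPV hPW x :
        symplecticGroup (polar (adelicForm F (Fin n) (adelicGram F e (PVᵀ * TV * PV) (PWᵀ * TW * PW))))) :
        ((Fin n → AdeleRing (𝓞 F) F) × (Fin n → AdeleRing (𝓞 F) F)) ≃ₗ[AdeleRing (𝓞 F) F] ((Fin n → AdeleRing (𝓞 F) F) × (Fin n → AdeleRing (𝓞 F) F))) v =
      congrRelabelLin F e hVd hWd hPV hPW (congrLeviLin F e hVd hWd hPV hPW
        ((x : ((Fin n → AdeleRing (𝓞 F) F) × (Fin n → AdeleRing (𝓞 F) F)) ≃ₗ[AdeleRing (𝓞 F) F] ((Fin n → AdeleRing (𝓞 F) F) × (Fin n → AdeleRing (𝓞 F) F))) ((congrLeviLin F e hVd hWd hPV hPW).symm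
          ((congrRelabelLin F e hVd hWd hPV hPW).symm v)))) :=
  rfl

/-- `π(q)` in coordinates: `π(q) (x, y) = (𝕡̂⁻¹ x, (𝕋⁻¹ 𝕡̂ᵀ 𝕋) y)`, `𝕡̂ = adelicGram e P_V P_W`. [cite: Weil1964, Chap. I n° 13 p. 160] -/
theorem congrLeviLin_apply (w : ((Fin n → AdeleRing (𝓞 F) F) × (Fin n → AdeleRing (𝓞 F) F))) :
    congrLeviLin F e hVd hWd hPV hPW w =
      ((((ratGL F (gramGL F e hPV hPW))⁻¹ : GL (Fin n) (AdeleRing (𝓞 F) F)) : Matrix (Fin n) (Fin n) (AdeleRing (𝓞 F) F)) *ᵥ w.1,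
        ((adelicGram F e TV TW)⁻¹ * (adelicGram F e PV PW)ᵀ * adelicGram F e TV TW) *ᵥ w.2) := by
  have hbb : ratGL F (gramGL F e hPV hPW)⁻¹ = (ratGL F (gramGL F e hPV hPW))⁻¹ := Matrix.GeneralLinearGroup.map_inv _ _
  delta congrLeviLin congrLeviPair
  rw [adelicMpCont.proj_apply, coe_leviPairCont, proj_leviPair, coe_leviSp_apply, glEquiv_apply, leviDual_apply, hbb, inv_inv,
    coe_ratGL_gramGL]

/-- restriction of scalars of `P`, reindexed by `e`: `ρ (R(P) (ρ⁻¹ (x, y))) = (𝕡̂ x, 𝕡̂ y)` (`resAut_map`).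
[cite: GelbartRogawski1991, §3.1 p. 454 L41–42] -/
theorem congrResLin_apply (w : ((Fin n → AdeleRing (𝓞 F) F) × (Fin n → AdeleRing (𝓞 F) F))) :
    congrResLin F E c e hcδ hδ hd hPV hPW w = (adelicGram F e PV PW *ᵥ w.1, adelicGram F e PV PW *ᵥ w.2) := by
  obtain ⟨x, y⟩ := w
  rw [congrResLin, LinearEquiv.trans_apply, LinearEquiv.trans_apply, UnitaryGroup.reindexW_symm_apply, kronGLAdele,
    (UnitaryGroup.isQuadraticCoordinates_adele E c hcδ hδ hd).resAut_map, UnitaryGroup.reindexW_apply]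
  have hP : ((Matrix.GeneralLinearGroup.map (algebraMap F (AdeleRing (𝓞 F) F)) (kronGL F N M hPV hPW) :
      GL (Fin N × Fin M) (AdeleRing (𝓞 F) F)) : Matrix (Fin N × Fin M) (Fin N × Fin M) (AdeleRing (𝓞 F) F)) =
      PV.map (algebraMap F (AdeleRing (𝓞 F) F)) ⊗ₖ PW.map (algebraMap F (AdeleRing (𝓞 F) F)) := by
    rw [UnitaryGroup.kronecker_map_map]; rfl
  have hre : ∀ z : Fin n → AdeleRing (𝓞 F) F, adelicGram F e PV PW *ᵥ z =
      ((PV.map (algebraMap F (AdeleRing (𝓞 F) F)) ⊗ₖ PW.map (algebraMap F (AdeleRing (𝓞 F) F))) *ᵥ (z ∘ e)) ∘ e.symm :=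
    fun z => by rw [adelicGram, Matrix.reindex_apply, Matrix.submatrix_mulVec_equiv, Equiv.symm_symm]
  rw [hP, hre, hre]

/-- **`Λ_C ∘ π(q) ∘ ρ R(P) ρ⁻¹ = 1`**: the relabelling times the Levi element is the inverse of the restriction of scalars
of `P` (`𝕡̂⁻¹ 𝕡̂ = 1`, `C 𝕋⁻¹ 𝕡̂ᵀ 𝕋 𝕡̂ = 𝕋′⁻¹ 𝕋′ = 1`). [cite: GelbartRogawski1991, §3.1 p. 454 L41–42] -/
theorem congrRelabelLin_congrLeviLin_congrResLin (w : ((Fin n → AdeleRing (𝓞 F) F) × (Fin n → AdeleRing (𝓞 F) F))) :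
    congrRelabelLin F e hVd hWd hPV hPW (congrLeviLin F e hVd hWd hPV hPW (congrResLin F E c e hcδ hδ hd hPV hPW w)) = w := by
  rw [congrResLin_apply, congrLeviLin_apply, congrRelabelLin, relabelVec_apply, Matrix.mulVec_mulVec, Matrix.mulVec_mulVec,
    Matrix.mulVec_mulVec, ← coe_ratGL_gramGL F e hPV hPW, Units.inv_mul, Matrix.one_mulVec]
  have h2 : ((relabelGL F (Fin n) (isUnit_det_adelicGram_congr F e hVd hWd hPV hPW) (isUnit_det_adelicGram F e hVd hWd) :
        GL (Fin n) (AdeleRing (𝓞 F) F)) : Matrix (Fin n) (Fin n) (AdeleRing (𝓞 F) F)) *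
      ((adelicGram F e TV TW)⁻¹ *
        ((ratGL F (gramGL F e hPV hPW) : GL (Fin n) (AdeleRing (𝓞 F) F)) : Matrix (Fin n) (Fin n) (AdeleRing (𝓞 F) F))ᵀ *
          adelicGram F e TV TW *
        ((ratGL F (gramGL F e hPV hPW) : GL (Fin n) (AdeleRing (𝓞 F) F)) : Matrix (Fin n) (Fin n) (AdeleRing (𝓞 F) F))) = 1 := by
    rw [coe_ratGL_gramGL, show ∀ C Ti Pt T P : Matrix (Fin n) (Fin n) (AdeleRing (𝓞 F) F),
      C * (Ti * Pt * T * P) = C * Ti * (Pt * T * P) from fun _ _ _ _ _ => by simp only [Matrix.mul_assoc],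
      relabelGL_mul_inv, ← adelicGram_congr, Matrix.nonsing_inv_mul _ (isUnit_det_adelicGram_congr F e hVd hWd hPV hPW)]
  rw [h2, Matrix.one_mulVec]

/-- the inverse form: `(ρ R(P) ρ⁻¹)⁻¹ (π(q)⁻¹ (Λ_C⁻¹ v)) = v`. [cite: GelbartRogawski1991, §3.1 p. 454 L41–42] -/
theorem congrResLin_symm_congrLeviLin_symm (v : ((Fin n → AdeleRing (𝓞 F) F) × (Fin n → AdeleRing (𝓞 F) F))) :
    (congrResLin F E c e hcδ hδ hd hPV hPW).symm ((congrLeviLin F e hVd hWd hPV hPW).symm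
      ((congrRelabelLin F e hVd hWd hPV hPW).symm v)) = v := by
  have h := congrRelabelLin_congrLeviLin_congrResLin F E c e hcδ hδ hd hVd hWd hPV hPW
    ((congrResLin F E c e hcδ hδ hd hPV hPW).symm ((congrLeviLin F e hVd hWd hPV hPW).symm
      ((congrRelabelLin F e hVd hWd hPV hPW).symm v)))
  rw [LinearEquiv.apply_symm_apply, LinearEquiv.apply_symm_apply, LinearEquiv.apply_symm_apply] at h
  exact h.symm

/-- **`ι′ = eSp ∘ ι ∘ eG`**: restriction of scalars of `P g P⁻¹` is `R(P) ι′(g) R(P)⁻¹`, and `R(P) = (Λ_C π(q))⁻¹`.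
[cite: GelbartRogawski1991, §3.1 p. 454 L41–42] -/
theorem toSp_congr
    (g : UnitaryGroup.adelicPair F E c N M ((PVᵀ * TV * PV).map (algebraMap F E)) ((PWᵀ * TW * PW).map (algebraMap F E))) :
    toSp F E c N M e _ _ hcδ hδ hd (isSymm_congr hV PV) (isSymm_congr hW PW) rfl rfl g =
      congrSp F e hVd hWd hPV hPW (toSp F E c N M e _ _ hcδ hδ hd hV hW rfl rfl (congrPair F E c N M hPV hPW TV TW g)) := by
  have hR : (UnitaryGroup.isQuadraticCoordinates_adele E c hcδ hδ hd).resAut (Fin N × Fin M)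
        ((congrPair F E c N M hPV hPW TV TW g : UnitaryGroup.adelicPair F E c N M (TV.map (algebraMap F E))
          (TW.map (algebraMap F E))) : GL (Fin N × Fin M) (AdeleRing (𝓞 E) E)) =
      (UnitaryGroup.isQuadraticCoordinates_adele E c hcδ hδ hd).resAut (Fin N × Fin M) (kronGLAdele F E N M hPV hPW) *
        (UnitaryGroup.isQuadraticCoordinates_adele E c hcδ hδ hd).resAut (Fin N × Fin M)
          (g : GL (Fin N × Fin M) (AdeleRing (𝓞 E) E)) *
        ((UnitaryGroup.isQuadraticCoordinates_adele E c hcδ hδ hd).resAut (Fin N × Fin M) (kronGLAdele F E N M hPV hPW))⁻¹ :=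
    ((congrArg _ (coe_congrPair_apply F E c N M hPV hPW TV TW g)).trans (MonoidHom.map_mul _ _ _)).trans
      (congrArg₂ (· * ·) (MonoidHom.map_mul _ _ _) (MonoidHom.map_inv _ _))
  -- `ρ R(g) ρ⁻¹ = (ρ R(P) ρ⁻¹) … ` bookkeeping: everything through the three named automorphisms
  have key : ∀ v : ((Fin n → AdeleRing (𝓞 F) F) × (Fin n → AdeleRing (𝓞 F) F)),
      UnitaryGroup.reindexW (AdeleRing (𝓞 F) F) e
        ((UnitaryGroup.isQuadraticCoordinates_adele E c hcδ hδ hd).resAut (Fin N × Fin M)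
          ((congrPair F E c N M hPV hPW TV TW g : UnitaryGroup.adelicPair F E c N M (TV.map (algebraMap F E))
            (TW.map (algebraMap F E))) : GL (Fin N × Fin M) (AdeleRing (𝓞 E) E))
          ((UnitaryGroup.reindexW (AdeleRing (𝓞 F) F) e).symm v)) =
      congrResLin F E c e hcδ hδ hd hPV hPW
        (UnitaryGroup.reindexW (AdeleRing (𝓞 F) F) e
          ((UnitaryGroup.isQuadraticCoordinates_adele E c hcδ hδ hd).resAut (Fin N × Fin M)
            (g : GL (Fin N × Fin M) (AdeleRing (𝓞 E) E))
            ((UnitaryGroup.reindexW (AdeleRing (𝓞 F) F) e).symm ((congrResLin F E c e hcδ hδ hd hPV hPW).symm v)))) := by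
    intro v
    rw [hR, LinearEquiv.mul_apply, LinearEquiv.mul_apply, LinearEquiv.coe_inv]
    simp only [congrResLin, LinearEquiv.trans_apply, LinearEquiv.trans_symm, LinearEquiv.symm_symm,
      LinearEquiv.symm_apply_apply]
  apply Subtype.ext
  apply LinearEquiv.ext
  intro v
  rw [coe_toSp_apply, coe_congrSp_apply, coe_toSp_apply, key, congrResLin_symm_congrLeviLin_symm,
    congrRelabelLin_congrLeviLin_congrResLin]

/-- `htoSp` in datum form. [cite: GelbartRogawski1991, §3.1 p. 454 L21–42] -/
theorem congrDatum_toSp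
    (g : UnitaryGroup.adelicPair F E c N M ((PVᵀ * TV * PV).map (algebraMap F E)) ((PWᵀ * TW * PW).map (algebraMap F E))) :
    (congrDatum F E c e hcδ hδ hd hV hW hVd hWd hPV hPW).toSp g =
      congrSp F e hVd hWd hPV hPW ((origDatum F E c e hcδ hδ hd hV hW hVd hWd).toSp
        ((congrPair F E c N M hPV hPW TV TW).toMonoidHom g)) :=
  toSp_congr F E c e hcδ hδ hd hV hW hVd hWd hPV hPW g

/-- **[GelbartRogawski1991, Prop. 3.1.1] AS A RECORD IS INVARIANT UNDER `F`-RATIONAL CONGRUENCE OF THE GRAM DATA**: a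
compatible splitting for the dual pair of `(T_V, T_W)` yields one for `(P_Vᵀ T_V P_V, P_Wᵀ T_W P_W)`, `P_V ∈ GL_N(F)`,
`P_W ∈ GL_M(F)` (`SplittingDatum.CompatibleSplitting.transport_of_unique` along `(eSp, φ, eG)`; the rational clause by the
uniqueness of the rational section, `splittingDatum_ratSplit_unique`). [cite: GelbartRogawski1991, §3.1 Prop. 3.1.1 p. 455 L1–3; p. 454 L21–42] -/
theorem compatibleSplitting_congr
    (h : (splittingDatum F E c N M e (TV.map (algebraMap F E)) (TW.map (algebraMap F E)) hcδ hδ hd hV hW hVd hWd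
      rfl rfl).CompatibleSplitting) :
    (splittingDatum F E c N M e ((PVᵀ * TV * PV).map (algebraMap F E)) ((PWᵀ * TW * PW).map (algebraMap F E)) hcδ hδ hd
      (isSymm_congr hV PV) (isSymm_congr hW PW) (isUnit_det_congr hVd hPV) (isUnit_det_congr hWd hPW)
      rfl rfl).CompatibleSplitting :=
  h.transport_of_unique (congrSp F e hVd hWd hPV hPW) (congrMp F e hVd hWd hPV hPW)
    (continuous_congrMp F e hVd hWd hPV hPW) (congrPair F E c N M hPV hPW TV TW).toMonoidHom
    (congrPair F E c N M hPV hPW TV TW).continuous (congrDatum_proj_congrMp F E c e hcδ hδ hd hV hW hVd hWd hPV hPW)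
    (congrDatum_toSp F E c e hcδ hδ hd hV hW hVd hWd hPV hPW)
    (congrDatum_ratPts F E c e hcδ hδ hd hV hW hVd hWd hPV hPW)
    (congrSpRat F e hVd hWd hPV hPW) (congrDatum_coe_congrSpRat F E c e hcδ hδ hd hV hW hVd hWd hPV hPW)
    (splittingDatum_ratSplit_unique F E c N M e _ _ hcδ hδ hd _ _ _ _ rfl rfl)

end Transport

end UnitaryDualPair

end Literature.NumberTheory.GelbartRogawski1991

end
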